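import Summits.BirchSwinnertonDyer.BirchSwinnertonDyer.Theorems.KatoDescentPotSupersingularASideLedgerSharp
import Summits.BirchSwinnertonDyer.BirchSwinnertonDyer.Theorems.KatoDescentPotSupersingularASideCountOfZetaLineOrthIndex
import Summits.BirchSwinnertonDyer.BirchSwinnertonDyer.Theorems.KatoDescentPotSupersingularZetaLineKummerToOrth
import HarnessLib

/-!
# The SHARP level-0 count of crux M (ONE torsion power):
# `p^{v_p(Tam W)} · #Ш(W)[p^∞] · [A : ℤ_p y₀] ≤ p^{v_p(c_p)} · #Sel_str^{ur}(W[p^∞]) · p^e · p^{v_p #W(ℚ)_tors}`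
# from the zeta line's local index at `p` (`ZetaLineOrthIndexAt` / the Kummer form `ZetaLineIndexAt`) and the named fact `poitouTate_selmerStructure_duality ℚ`
# — parts 50/52/54/58 re-run on the sharp ledger (`…ASideLedgerSharp`), in which the junction's torsion factor has cancelled
# (route `KatoDescentPotSupersingular` / `…Tame…`, crux M = stmt-BirchSwinnertonDyer-19196, U₀-red 19190/19203; route-free helper)

Seat `bsd-potss-rkm` g24 (prover; cell `bsd-potss`), TARGET R283 / wake W-M6 (`--supports …`; closes nothing).  HONEST FRAMING: BSD is not
proved by any of this; nothing is booked; theorems only (no definition, no named fact).  CONDITIONAL on the named fact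
`poitouTate_selmerStructure_duality ℚ` (a THEOREM of the tree since 2026-08-28, `InputsPoitouTateSelmer.poitouTate_selmerStructure_duality_conj_holds`;
carried as a hypothesis here exactly as in part 58) and on the displayed zeta-line predicate (clause (b′) of the held package of crux M).

## What

* `count_arith_sharp` — the assembly with one torsion factor;
* `exists_forall_aSide_sharp_le_classical` — the sharp ledger (`…ASideLedgerSharp.exists_forall_aSide_sharp_le`) in classical invariants (rank `0`):
  `p^{v_p(Tam W)} · #Ш(W)[p^∞] · [B_k(ℤ_p y₀) : B_k(ℤ_p y₀) ⊓ 𝓚_k^⊥] · [A : ℤ_p y₀] ≤ p^{v_p(c_p)} · (#Sel_str^{ur} · p^k · #W(ℚ)[p^k])` (part 50 without `#W(ℚ)[p^N]`);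
* `exists_forall_aSide_sharp_le_classical_of_dvd` — the same with brick (b) in counting form `p^N ∣ [B_k(ℤ_p y₀) : B_k(ℤ_p y₀) ⊓ 𝓚_k^⊥]` (part 52);
* **`tamagawa_mul_sha_mul_index_le_sharp_of_zetaLineOrthIndexAt`** — the displayed count from `ZetaLineOrthIndexAt W p y₀ e` (part 58's proof verbatim on
  the sharp ledger; `#W(ℚ)[p^k] ∣ p^{v_p #W(ℚ)_tors}`);
* **`tamagawa_mul_sha_mul_index_le_sharp_of_zetaLineIndexAt`** — the same from the PRINT (Kummer) form `ZetaLineIndexAt W p y₀ e`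
  (clause (b′) of `MemberHullZetaKummerCoreInputs`), through g22's bridge `zetaLineOrthIndexAt_of_zetaLineIndexAt`.

READING.  With `e = ord_p(L(W,1)/Ω) + v_p λ(0) + t_p − v_p(c_p)` (Kato Lemma 14.18 + Kim §3.2.3) and (c2′) `ord_p #(𝐇²/X𝐇²) + t₀ = ord_p #Sel_str^{ur} + t_p`:
`ord_p #Ш + v_p Tam + ord_p [A : ℤ_p y₀] ≤ ord_p(L/Ω) + v_p λ(0) + ord_p #(𝐇²/X𝐇²) + 2·ord_p #W(ℚ)_tors` — Kato's Prop. 14.16 (2) at a member with rational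
`p`-torsion, the `count` of the SHARP member package (`MemberCountInputs.exactCount`'s `≤` half), one `ord_p #W(ℚ)_tors` below part 58.

References: K. Kato, Astérisque 295 (2004), §14.8 (p. 238), (14.9.3) (p. 240), Prop. 14.16 and its proof (pp. 244–245), Lemma 14.18 (pp. 247–248)
[Kato2004Asterisque]; R. Greenberg, LNM 1716 (1999), appendix to §4 [GreenbergLNM1716]; J. S. Milne, *ADT* I Cor. 2.3, Thm. 2.6, Thm. 4.10 (b)
[MilneADT2006]; B. Howard, Compos. Math. 140 (2004) Thm. 2.1.11 [Howard2004HeegnerKolyvagin]; J. H. Silverman, *AEC* III.8.1, VII.3 [SilvermanAEC2009].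
-/

-- the summit and its single problem are both named `BirchSwinnertonDyer` (registry layout D-0017)
set_option linter.dupNamespace false
set_option autoImplicit false

noncomputable section

open scoped Classical ContRepresentation NumberField AddSubgroup
open CategoryTheory Function Field NumberField IsDedekindDomain WeierstrassCurve
open Literature.NumberTheory.EllipticCurves Literature.NumberTheory.GaloisRepresentations
  Literature.NumberTheory.GaloisRepresentations.DiscreteGaloisModule Literature.NumberTheory.GaloisCohomology
open Literature.NumberTheory.EllipticCurves.Kato2004 Literature.NumberTheory.EllipticCurves.Kato2004.EulerSystemValues
open Summit.BirchSwinnertonDyer.Rank1Residual.X11b.Levels Summit.BirchSwinnertonDyer.Rank1Residual.X11b.LocBridge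
  Summit.BirchSwinnertonDyer.Rank1Residual.X11b.LevelKummer Summit.BirchSwinnertonDyer.Rank1Residual.X11b.FiniteDuality
  Summit.BirchSwinnertonDyer.Rank1Residual.X11b.AcSelmer
open Summit.BirchSwinnertonDyer.Rank1Residual.GaloisImage
open Summit.BirchSwinnertonDyer.BirchSwinnertonDyer.Theorems.KummerTowerOrthogonal
open Summit.BirchSwinnertonDyer.BirchSwinnertonDyer.Theorems.ASideJunction
open Summit.BirchSwinnertonDyer.BirchSwinnertonDyer.Theorems.KummerDescendedDuality

namespace Summit.BirchSwinnertonDyer.BirchSwinnertonDyer.Theorems.KatoFiniteLevelCount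

/-! ## §1 Arithmetic -/

section Arith

/-- The assembly with ONE torsion factor: `T·S·r·i ≤ C·(L·pk·tk)`, `pk ≤ r·pe`, `tk ≤ t1`, `0 < pk` give `T·S·i ≤ C·L·pe·t1`. [folklore] -/
theorem count_arith_sharp {T S r i C L pk tk pe t1 : ℕ} (h : T * S * r * i ≤ C * (L * pk * tk)) (hr : pk ≤ r * pe)
    (ht : tk ≤ t1) (hpk : 0 < pk) : T * S * i ≤ C * L * pe * t1 := by
  have h1 : T * S * i * pk ≤ C * L * pe * tk * pk :=
    calc T * S * i * pk ≤ T * S * i * (r * pe) := Nat.mul_le_mul_left _ hr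
      _ = T * S * r * i * pe := by ring
      _ ≤ C * (L * pk * tk) * pe := Nat.mul_le_mul_right _ h
      _ = C * L * pe * tk * pk := by ring
  exact (Nat.le_of_mul_le_mul_right h1 hpk).trans (Nat.mul_le_mul_left _ ht)

end Arith

/-! ## §2 The sharp ledger in classical invariants, and with brick (b) in counting form -/

section Classical

variable (W : WeierstrassCurve ℚ) [W.IsElliptic] (p : ℕ) [Fact p.Prime] [ContinuousSMul ℤ_[p] (W.tateModule p)]
  (𝓤inf 𝓢inf : SelmerStructure (primaryGaloisModule W p))

/-- **THE SHARP A⊕S LEDGER IN CLASSICAL INVARIANTS (rank `0`)**: part 50 on the sharp ledger —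
`p^{v_p(Tam W)} · #Ш(W)[p^∞] · [B_k(ℤ_p y₀) : B_k(ℤ_p y₀) ⊓ 𝓚_k^⊥] · [A : ℤ_p y₀] ≤ p^{v_p(c_p)} · (#Sel_str^{ur} · p^k · #W(ℚ)[p^k])`.
[cite: Kato2004Asterisque, §14.8 (p. 238), (14.9.3) (p. 240), Prop. 14.16 and its proof (pp. 244–245), Lemma 14.18 (pp. 247–248)]
[cite: GreenbergLNM1716, §1 p. 54 and §4 p. 103] -/
theorem exists_forall_aSide_sharp_le_classical (hodd : p ≠ 2) (T : Finset (HeightOneSpectrum (𝓞 ℚ)))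
    (hpT : primePlace p ∈ T) (hT : ∀ v : HeightOneSpectrum (𝓞 ℚ), v ∉ T → W.HasGoodReductionAt v)
    [Finite W.toAffine.Point] [Finite (AddCommGroup.primaryComponent (↥W.sha) p)]
    (hUp : 𝓤inf (Sum.inr (primePlace p)) = ⊤)
    (hUur : ∀ v : HeightOneSpectrum (𝓞 ℚ), v ≠ primePlace p →
      𝓤inf (Sum.inr v) = unramifiedSubgroup (GaloisRep.toLocal v (primaryGaloisModule W p)) 1)
    (hUinl : ∀ w : InfinitePlace ℚ, 𝓤inf (Sum.inl w) = ⊤)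
    (hSp : 𝓢inf (Sum.inr (primePlace p)) = ⊥)
    (hSur : ∀ v : HeightOneSpectrum (𝓞 ℚ), v ≠ primePlace p →
      𝓢inf (Sum.inr v) = unramifiedSubgroup (GaloisRep.toLocal v (primaryGaloisModule W p)) 1)
    (hSinl : ∀ w : InfinitePlace ℚ, 𝓢inf (Sum.inl w) = ⊤)
    (y₀ : H1 (tateRep W p) ⊤) (hy₀ : y₀ ∈ integralH1 (tateRep W p) p ⊤) (N : ℕ)
    (hN : ∀ a ∈ integralH1 (tateRep W p) p ⊤, ((p ^ N : ℕ) : ℤ) • a ∈ (ℤ_[p] ∙ y₀).toAddSubgroup) :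
    ∃ j s k₀ : ℕ, ∀ k : ℕ, k₀ ≤ k →
      haveI := neZero_pow p j; haveI := neZero_pow p s; haveI := neZero_pow p k
      haveI : Finite (geomTorsion W ((p ^ k : ℕ) : ℤ)) := finite_geomTorsion_pow W p k
      haveI : Finite (geomTorsion W ((p ^ s * p ^ k : ℕ) : ℤ)) :=
        W.finite_torsionPoints_holds (AlgebraicClosure ℚ) (Int.natCast_ne_zero.mpr (NeZero.ne (p ^ s * p ^ k)))
      ∀ (inv : LocalInvariants ℚ (p ^ j * p ^ k)), inv.SumLocalTermEqZero → inv.IsPerfect →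
      ∀ (ε : geomTorsion W ((p ^ j * p ^ k : ℕ) : ℤ) → geomTorsion W ((p ^ j * p ^ k : ℕ) : ℤ) → AlgebraicClosure ℚ)
        (hμ : ∀ S T, ε S T ^ (p ^ j * p ^ k) = 1)
        (hadd₁ : ∀ S₁ S₂ T, ε (S₁ + S₂) T = ε S₁ T * ε S₂ T)
        (hadd₂ : ∀ S T₁ T₂, ε S (T₁ + T₂) = ε S T₁ * ε S T₂)
        (hgal : ∀ (σ : absoluteGaloisGroup ℚ) (S T : geomTorsion W ((p ^ j * p ^ k : ℕ) : ℤ)), σ • ε S T = ε (σ • S) (σ • T)),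
      (∀ y ∈ (ℤ_[p] ∙ y₀).toAddSubgroup,
        ((galoisCohomology.localization ((W.torsionGaloisModule ((p ^ k : ℕ) : ℤ)).tateDual (p ^ j * p ^ k))
              (Sum.inr (primePlace p)) 1).comp
            ((galoisCohomology.map (DiscreteGaloisModule.pairingDualIntertwining
                (ρ₁ := W.torsionGaloisModule ((p ^ k : ℕ) : ℤ)) (ρ₂ := W.torsionGaloisModule ((p ^ k : ℕ) : ℤ))
                (B := descendHom W (p ^ j) (p ^ k) ε hμ hadd₁ hadd₂)
                (descendHom_smul W (p ^ j) (p ^ k) ε hμ hadd₁ hadd₂ hgal)) 1).comp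
              (((galoisCohomology.map (W.torsionInclusion (intPow_dvd_natCast_pow p k)) 1).comp
                  (ofTopSubgroup (W.torsionGaloisModule ((p : ℤ) ^ k)).toTopRep 1).hom.toLinearMap.toAddMonoidHom).comp
                (reduceH1Pk W p k ⊤)))) y ∈
          annRight (localTatePairingZMod (W.torsionGaloisModule ((p ^ k : ℕ) : ℤ)) (p ^ j * p ^ k)
            (Sum.inr (primePlace p)) (inv (Sum.inr (primePlace p))))
            (W.kummerSelmerStructure ((p ^ k : ℕ) : ℤ) (Sum.inr (primePlace p))) →
        ∃ y' ∈ (ℤ_[p] ∙ y₀).toAddSubgroup, ((p ^ N : ℕ) : ℤ) • y' = y) →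
      ∀ (e : geomTorsion W ((p ^ s * p ^ k : ℕ) : ℤ) → geomTorsion W ((p ^ s * p ^ k : ℕ) : ℤ) → AlgebraicClosure ℚ)
        (hμ' : ∀ S T, e S T ^ (p ^ s * p ^ k) = 1)
        (hadd₁' : ∀ S₁ S₂ T, e (S₁ + S₂) T = e S₁ T * e S₂ T)
        (hadd₂' : ∀ S T₁ T₂, e S (T₁ + T₂) = e S T₁ * e S T₂)
        (hgal' : ∀ (σ : absoluteGaloisGroup ℚ) (S T : geomTorsion W ((p ^ s * p ^ k : ℕ) : ℤ)), σ • e S T = e (σ • S) (σ • T)),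
        (∀ P, e P P = 1) → (∀ P, (∀ Q, e Q P = 1) → P = 0) →
      ∀ (inv' : LocalInvariants ℚ (p ^ s * p ^ k)), inv'.IsPerfect → inv'.SelmerComplement →
      p ^ padicValNat p W.tamagawaProduct * Nat.card (AddCommGroup.primaryComponent (↥W.sha) p) *
            ((((ℤ_[p] ∙ y₀).toAddSubgroup.map
                  (((galoisCohomology.map (W.torsionInclusion (intPow_dvd_natCast_pow p k)) 1).comp
                      (ofTopSubgroup (W.torsionGaloisModule ((p : ℤ) ^ k)).toTopRep 1).hom.toLinearMap.toAddMonoidHom).comp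
                    (reduceH1Pk W p k ⊤))).map
                  (galoisCohomology.map (DiscreteGaloisModule.pairingDualIntertwining
                    (ρ₁ := W.torsionGaloisModule ((p ^ k : ℕ) : ℤ)) (ρ₂ := W.torsionGaloisModule ((p ^ k : ℕ) : ℤ))
                    (B := descendHom W (p ^ j) (p ^ k) ε hμ hadd₁ hadd₂)
                    (descendHom_smul W (p ^ j) (p ^ k) ε hμ hadd₁ hadd₂ hgal)) 1)).map
                (galoisCohomology.localization ((W.torsionGaloisModule ((p ^ k : ℕ) : ℤ)).tateDual (p ^ j * p ^ k))
                  (Sum.inr (primePlace p)) 1) ⊓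
              annRight (localTatePairingZMod (W.torsionGaloisModule ((p ^ k : ℕ) : ℤ)) (p ^ j * p ^ k)
                (Sum.inr (primePlace p)) (inv (Sum.inr (primePlace p))))
                (W.kummerSelmerStructure ((p ^ k : ℕ) : ℤ) (Sum.inr (primePlace p)))).relIndex
              ((((ℤ_[p] ∙ y₀).toAddSubgroup.map
                  (((galoisCohomology.map (W.torsionInclusion (intPow_dvd_natCast_pow p k)) 1).comp
                      (ofTopSubgroup (W.torsionGaloisModule ((p : ℤ) ^ k)).toTopRep 1).hom.toLinearMap.toAddMonoidHom).comp
                    (reduceH1Pk W p k ⊤))).map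
                  (galoisCohomology.map (DiscreteGaloisModule.pairingDualIntertwining
                    (ρ₁ := W.torsionGaloisModule ((p ^ k : ℕ) : ℤ)) (ρ₂ := W.torsionGaloisModule ((p ^ k : ℕ) : ℤ))
                    (B := descendHom W (p ^ j) (p ^ k) ε hμ hadd₁ hadd₂)
                    (descendHom_smul W (p ^ j) (p ^ k) ε hμ hadd₁ hadd₂ hgal)) 1)).map
                (galoisCohomology.localization ((W.torsionGaloisModule ((p ^ k : ℕ) : ℤ)).tateDual (p ^ j * p ^ k))
                  (Sum.inr (primePlace p)) 1)) *
            ((ℤ_[p] ∙ y₀).toAddSubgroup.relIndex (integralH1 (tateRep W p) p ⊤).toAddSubgroup) ≤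
        p ^ padicValNat p ((W.baseChange ((primePlace p).adicCompletion ℚ)).localTamagawaNumber
            ((primePlace p).adicCompletionIntegers ℚ)) *
          (Nat.card 𝓢inf.selmerGroup * p ^ k * Nat.card ↥(W.toAffine.Point[((p ^ k : ℕ) : ℤ)])) := by
  haveI : Finite (W.selmerGroupPInfty p) := Nat.finite_of_card_ne_zero (by
    rw [W.natCard_selmerGroupPInfty_eq_natCard_primaryComponent_sha p]; exact Nat.card_pos.ne')
  obtain ⟨j, s, k₀, hA⟩ := exists_forall_aSide_sharp_le W p 𝓤inf 𝓢inf hodd T hpT hT hUp hUur hUinl hSp hSur hSinl y₀ hy₀ N hN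
  refine ⟨j, s, k₀, fun k hk => ?_⟩
  intro inv hsum hperf ε hμ hadd₁ hadd₂ hgal hY e hμ' hadd₁' hadd₂' hgal' halt hnondeg inv' hperf' hcompl'
  have h1 := hA k hk inv hsum hperf ε hμ hadd₁ hadd₂ hgal hY e hμ' hadd₁' hadd₂' hgal' halt hnondeg inv' hperf' hcompl'
  rw [W.natCard_selmerGroupPInfty_eq_natCard_primaryComponent_sha p, index_range_zsmul_eq_natCard_torsionBy] at h1
  exact mul_tamagawa_le (pow_padicValNat_tamagawaProduct_le_rat W p T hpT hT) h1

/-- **THE SHARP LEDGER IN CLASSICAL INVARIANTS WITH BRICK (b) IN COUNTING FORM**: part 52 on the sharp ledger —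
`p^{v_p(Tam W)} · #Ш(W)[p^∞] · [B_k(ℤ_p y₀) : B_k(ℤ_p y₀) ⊓ 𝓚_k^⊥] · [A : ℤ_p y₀] ≤ p^{v_p(c_p)} · (#Sel_str^{ur} · p^k · #W(ℚ)[p^k])`, the zeta-line saturation
replaced by `p^N ∣ [B_k(ℤ_p y₀) : B_k(ℤ_p y₀) ⊓ 𝓚_k^⊥]`.
[cite: Kato2004Asterisque, §14.8 (p. 238), (14.9.3) (p. 240), Prop. 14.16 and its proof (pp. 244–245), Lemma 14.18 (pp. 247–248)]
[cite: MilneADT2006, Ch. I, Cor. 2.3, Lemma 3.3] -/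
theorem exists_forall_aSide_sharp_le_classical_of_dvd (hodd : p ≠ 2) (T : Finset (HeightOneSpectrum (𝓞 ℚ)))
    (hpT : primePlace p ∈ T) (hT : ∀ v : HeightOneSpectrum (𝓞 ℚ), v ∉ T → W.HasGoodReductionAt v)
    [Finite W.toAffine.Point] [Finite (AddCommGroup.primaryComponent (↥W.sha) p)]
    (hUp : 𝓤inf (Sum.inr (primePlace p)) = ⊤)
    (hUur : ∀ v : HeightOneSpectrum (𝓞 ℚ), v ≠ primePlace p →
      𝓤inf (Sum.inr v) = unramifiedSubgroup (GaloisRep.toLocal v (primaryGaloisModule W p)) 1)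
    (hUinl : ∀ w : InfinitePlace ℚ, 𝓤inf (Sum.inl w) = ⊤)
    (hSp : 𝓢inf (Sum.inr (primePlace p)) = ⊥)
    (hSur : ∀ v : HeightOneSpectrum (𝓞 ℚ), v ≠ primePlace p →
      𝓢inf (Sum.inr v) = unramifiedSubgroup (GaloisRep.toLocal v (primaryGaloisModule W p)) 1)
    (hSinl : ∀ w : InfinitePlace ℚ, 𝓢inf (Sum.inl w) = ⊤)
    (y₀ : H1 (tateRep W p) ⊤) (hy₀ : y₀ ∈ integralH1 (tateRep W p) p ⊤) (N : ℕ)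
    (hN : ∀ a ∈ integralH1 (tateRep W p) p ⊤, ((p ^ N : ℕ) : ℤ) • a ∈ (ℤ_[p] ∙ y₀).toAddSubgroup) :
    ∃ j s k₀ : ℕ, ∀ k : ℕ, k₀ ≤ k →
      haveI := neZero_pow p j; haveI := neZero_pow p s; haveI := neZero_pow p k
      haveI : Finite (geomTorsion W ((p ^ k : ℕ) : ℤ)) := finite_geomTorsion_pow W p k
      haveI : Finite (geomTorsion W ((p ^ s * p ^ k : ℕ) : ℤ)) :=
        W.finite_torsionPoints_holds (AlgebraicClosure ℚ) (Int.natCast_ne_zero.mpr (NeZero.ne (p ^ s * p ^ k)))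
      ∀ (inv : LocalInvariants ℚ (p ^ j * p ^ k)), inv.SumLocalTermEqZero → inv.IsPerfect →
      ∀ (ε : geomTorsion W ((p ^ j * p ^ k : ℕ) : ℤ) → geomTorsion W ((p ^ j * p ^ k : ℕ) : ℤ) → AlgebraicClosure ℚ)
        (hμ : ∀ S T, ε S T ^ (p ^ j * p ^ k) = 1)
        (hadd₁ : ∀ S₁ S₂ T, ε (S₁ + S₂) T = ε S₁ T * ε S₂ T)
        (hadd₂ : ∀ S T₁ T₂, ε S (T₁ + T₂) = ε S T₁ * ε S T₂)
        (hgal : ∀ (σ : absoluteGaloisGroup ℚ) (S T : geomTorsion W ((p ^ j * p ^ k : ℕ) : ℤ)), σ • ε S T = ε (σ • S) (σ • T)),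
      p ^ N ∣ ((((ℤ_[p] ∙ y₀).toAddSubgroup.map
                  (((galoisCohomology.map (W.torsionInclusion (intPow_dvd_natCast_pow p k)) 1).comp
                      (ofTopSubgroup (W.torsionGaloisModule ((p : ℤ) ^ k)).toTopRep 1).hom.toLinearMap.toAddMonoidHom).comp
                    (reduceH1Pk W p k ⊤))).map
                  (galoisCohomology.map (DiscreteGaloisModule.pairingDualIntertwining
                    (ρ₁ := W.torsionGaloisModule ((p ^ k : ℕ) : ℤ)) (ρ₂ := W.torsionGaloisModule ((p ^ k : ℕ) : ℤ))
                    (B := descendHom W (p ^ j) (p ^ k) ε hμ hadd₁ hadd₂)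
                    (descendHom_smul W (p ^ j) (p ^ k) ε hμ hadd₁ hadd₂ hgal)) 1)).map
                (galoisCohomology.localization ((W.torsionGaloisModule ((p ^ k : ℕ) : ℤ)).tateDual (p ^ j * p ^ k))
                  (Sum.inr (primePlace p)) 1) ⊓
              annRight (localTatePairingZMod (W.torsionGaloisModule ((p ^ k : ℕ) : ℤ)) (p ^ j * p ^ k)
                (Sum.inr (primePlace p)) (inv (Sum.inr (primePlace p))))
                (W.kummerSelmerStructure ((p ^ k : ℕ) : ℤ) (Sum.inr (primePlace p)))).relIndex
              ((((ℤ_[p] ∙ y₀).toAddSubgroup.map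
                  (((galoisCohomology.map (W.torsionInclusion (intPow_dvd_natCast_pow p k)) 1).comp
                      (ofTopSubgroup (W.torsionGaloisModule ((p : ℤ) ^ k)).toTopRep 1).hom.toLinearMap.toAddMonoidHom).comp
                    (reduceH1Pk W p k ⊤))).map
                  (galoisCohomology.map (DiscreteGaloisModule.pairingDualIntertwining
                    (ρ₁ := W.torsionGaloisModule ((p ^ k : ℕ) : ℤ)) (ρ₂ := W.torsionGaloisModule ((p ^ k : ℕ) : ℤ))
                    (B := descendHom W (p ^ j) (p ^ k) ε hμ hadd₁ hadd₂)
                    (descendHom_smul W (p ^ j) (p ^ k) ε hμ hadd₁ hadd₂ hgal)) 1)).map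
                (galoisCohomology.localization ((W.torsionGaloisModule ((p ^ k : ℕ) : ℤ)).tateDual (p ^ j * p ^ k))
                  (Sum.inr (primePlace p)) 1)) →
      ∀ (e : geomTorsion W ((p ^ s * p ^ k : ℕ) : ℤ) → geomTorsion W ((p ^ s * p ^ k : ℕ) : ℤ) → AlgebraicClosure ℚ)
        (hμ' : ∀ S T, e S T ^ (p ^ s * p ^ k) = 1)
        (hadd₁' : ∀ S₁ S₂ T, e (S₁ + S₂) T = e S₁ T * e S₂ T)
        (hadd₂' : ∀ S T₁ T₂, e S (T₁ + T₂) = e S T₁ * e S T₂)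
        (hgal' : ∀ (σ : absoluteGaloisGroup ℚ) (S T : geomTorsion W ((p ^ s * p ^ k : ℕ) : ℤ)), σ • e S T = e (σ • S) (σ • T)),
        (∀ P, e P P = 1) → (∀ P, (∀ Q, e Q P = 1) → P = 0) →
      ∀ (inv' : LocalInvariants ℚ (p ^ s * p ^ k)), inv'.IsPerfect → inv'.SelmerComplement →
      p ^ padicValNat p W.tamagawaProduct * Nat.card (AddCommGroup.primaryComponent (↥W.sha) p) *
            ((((ℤ_[p] ∙ y₀).toAddSubgroup.map
                  (((galoisCohomology.map (W.torsionInclusion (intPow_dvd_natCast_pow p k)) 1).comp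
                      (ofTopSubgroup (W.torsionGaloisModule ((p : ℤ) ^ k)).toTopRep 1).hom.toLinearMap.toAddMonoidHom).comp
                    (reduceH1Pk W p k ⊤))).map
                  (galoisCohomology.map (DiscreteGaloisModule.pairingDualIntertwining
                    (ρ₁ := W.torsionGaloisModule ((p ^ k : ℕ) : ℤ)) (ρ₂ := W.torsionGaloisModule ((p ^ k : ℕ) : ℤ))
                    (B := descendHom W (p ^ j) (p ^ k) ε hμ hadd₁ hadd₂)
                    (descendHom_smul W (p ^ j) (p ^ k) ε hμ hadd₁ hadd₂ hgal)) 1)).map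
                (galoisCohomology.localization ((W.torsionGaloisModule ((p ^ k : ℕ) : ℤ)).tateDual (p ^ j * p ^ k))
                  (Sum.inr (primePlace p)) 1) ⊓
              annRight (localTatePairingZMod (W.torsionGaloisModule ((p ^ k : ℕ) : ℤ)) (p ^ j * p ^ k)
                (Sum.inr (primePlace p)) (inv (Sum.inr (primePlace p))))
                (W.kummerSelmerStructure ((p ^ k : ℕ) : ℤ) (Sum.inr (primePlace p)))).relIndex
              ((((ℤ_[p] ∙ y₀).toAddSubgroup.map
                  (((galoisCohomology.map (W.torsionInclusion (intPow_dvd_natCast_pow p k)) 1).comp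
                      (ofTopSubgroup (W.torsionGaloisModule ((p : ℤ) ^ k)).toTopRep 1).hom.toLinearMap.toAddMonoidHom).comp
                    (reduceH1Pk W p k ⊤))).map
                  (galoisCohomology.map (DiscreteGaloisModule.pairingDualIntertwining
                    (ρ₁ := W.torsionGaloisModule ((p ^ k : ℕ) : ℤ)) (ρ₂ := W.torsionGaloisModule ((p ^ k : ℕ) : ℤ))
                    (B := descendHom W (p ^ j) (p ^ k) ε hμ hadd₁ hadd₂)
                    (descendHom_smul W (p ^ j) (p ^ k) ε hμ hadd₁ hadd₂ hgal)) 1)).map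
                (galoisCohomology.localization ((W.torsionGaloisModule ((p ^ k : ℕ) : ℤ)).tateDual (p ^ j * p ^ k))
                  (Sum.inr (primePlace p)) 1)) *
            ((ℤ_[p] ∙ y₀).toAddSubgroup.relIndex (integralH1 (tateRep W p) p ⊤).toAddSubgroup) ≤
        p ^ padicValNat p ((W.baseChange ((primePlace p).adicCompletion ℚ)).localTamagawaNumber
            ((primePlace p).adicCompletionIntegers ℚ)) *
          (Nat.card 𝓢inf.selmerGroup * p ^ k * Nat.card ↥(W.toAffine.Point[((p ^ k : ℕ) : ℤ)])) := by
  obtain ⟨j, s, k₀, hA⟩ :=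
    exists_forall_aSide_sharp_le_classical W p 𝓤inf 𝓢inf hodd T hpT hT hUp hUur hUinl hSp hSur hSinl y₀ hy₀ N hN
  refine ⟨j, s, k₀, fun k hk => ?_⟩
  intro inv hsum hperf ε hμ hadd₁ hadd₂ hgal hdvd e hμ' hadd₁' hadd₂' hgal' halt hnondeg inv' hperf' hcompl'
  haveI := neZero_pow p j; haveI := neZero_pow p k
  haveI : Finite (geomTorsion W ((p ^ k : ℕ) : ℤ)) := finite_geomTorsion_pow W p k
  -- the count as an index in `H¹(ℚ, T_pE)`: `p^N ∣ [Y : Y ⊓ f_k⁻¹(𝓚_k^⊥)]`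
  simp only [AddSubgroup.map_map] at hdvd
  rw [relIndex_map_inf_eq_relIndex_comap] at hdvd
  -- the target of `f_k` is killed by `p^j p^k`
  have hB : ∀ y : galoisCohomology (((W.torsionGaloisModule ((p ^ k : ℕ) : ℤ)).tateDual (p ^ j * p ^ k)).toLocal
      (Sum.inr (primePlace p))) 1, (p ^ j * p ^ k) • y = 0 :=
    galoisCohomology.nsmul_eq_zero_of_forall _ fun f => DiscreteGaloisModule.TateDual.nsmul_eq_zero f
  have hcast : ∀ c : ℤ_[p], ((p : ℤ_[p]) ^ (j + k) * c) • y₀ = (p ^ j * p ^ k) • (c • y₀) := fun c => by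
    rw [mul_smul, ← Nat.cast_smul_eq_nsmul ℤ_[p] (p ^ j * p ^ k), Nat.cast_mul, Nat.cast_pow, Nat.cast_pow, pow_add]
  have hsat := exists_mem_smul_eq_of_pow_dvd_relIndex y₀ _ (j + k) (fun c => by
    rw [AddSubgroup.mem_comap, hcast c, map_nsmul, hB]; exact AddSubgroup.zero_mem _) N hdvd
  exact hA k hk inv hsum hperf ε hμ hadd₁ hadd₂ hgal (fun y hy hfy => hsat y hy (AddSubgroup.mem_comap.mpr hfy))
    e hμ' hadd₁' hadd₂' hgal' halt hnondeg inv' hperf' hcompl'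

end Classical

/-! ## §3 The sharp count from the zeta line's local index at `p` -/

section Count

variable (W : WeierstrassCurve ℚ) [W.IsElliptic] (p : ℕ) [Fact p.Prime] [ContinuousSMul ℤ_[p] (W.tateModule p)]
  (𝓤inf 𝓢inf : SelmerStructure (primaryGaloisModule W p))

/-- **THE SHARP LEVEL-0 COUNT OF CRUX M FROM `ZetaLineOrthIndexAt`:
`p^{v_p(Tam W)} · #Ш(W)[p^∞] · [A : ℤ_p y₀] ≤ p^{v_p(c_p)} · #Sel_str^{ur}(W[p^∞]) · p^e · p^{v_p #W(ℚ)_tors}`** — part 58 on the sharp ledger (`W(ℚ)` finite,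
`Ш(W)[p^∞]` finite, `p` odd, `y₀ ∈ A = H¹(ℤ[1/p], T_pW)` with `p^N A ⊆ ℤ_p y₀`, `ZetaLineOrthIndexAt W p y₀ e` displayed, the named fact
`poitouTate_selmerStructure_duality ℚ`).  ONE torsion power: `#W(ℚ)[p^k] ∣ p^{v_p #W(ℚ)_tors}`.
[cite: Kato2004Asterisque, §14.8 (p. 238), (14.9.3) (p. 240), Prop. 14.16 and its proof (pp. 244–245), Lemma 14.18 (pp. 247–248)]
[cite: MilneADT2006, Ch. I, Cor. 2.3, Thm. 2.6, Thm. 4.10 (b)] [cite: Howard2004HeegnerKolyvagin, Thm. 2.1.11] [cite: SilvermanAEC2009, Prop. III.8.1] -/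
theorem tamagawa_mul_sha_mul_index_le_sharp_of_zetaLineOrthIndexAt (hPT : poitouTate_selmerStructure_duality ℚ) (hodd : p ≠ 2)
    (T : Finset (HeightOneSpectrum (𝓞 ℚ)))
    (hpT : primePlace p ∈ T) (hT : ∀ v : HeightOneSpectrum (𝓞 ℚ), v ∉ T → W.HasGoodReductionAt v)
    [Finite W.toAffine.Point] [Finite (AddCommGroup.primaryComponent (↥W.sha) p)]
    (hUp : 𝓤inf (Sum.inr (primePlace p)) = ⊤)
    (hUur : ∀ v : HeightOneSpectrum (𝓞 ℚ), v ≠ primePlace p →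
      𝓤inf (Sum.inr v) = unramifiedSubgroup (GaloisRep.toLocal v (primaryGaloisModule W p)) 1)
    (hUinl : ∀ w : InfinitePlace ℚ, 𝓤inf (Sum.inl w) = ⊤)
    (hSp : 𝓢inf (Sum.inr (primePlace p)) = ⊥)
    (hSur : ∀ v : HeightOneSpectrum (𝓞 ℚ), v ≠ primePlace p →
      𝓢inf (Sum.inr v) = unramifiedSubgroup (GaloisRep.toLocal v (primaryGaloisModule W p)) 1)
    (hSinl : ∀ w : InfinitePlace ℚ, 𝓢inf (Sum.inl w) = ⊤)
    (y₀ : H1 (tateRep W p) ⊤) (hy₀ : y₀ ∈ integralH1 (tateRep W p) p ⊤) (N : ℕ)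
    (hN : ∀ a ∈ integralH1 (tateRep W p) p ⊤, ((p ^ N : ℕ) : ℤ) • a ∈ (ℤ_[p] ∙ y₀).toAddSubgroup) (e : ℕ)
    (hb : ZetaLineOrthIndexAt W p y₀ e) :
    p ^ padicValNat p W.tamagawaProduct * Nat.card (AddCommGroup.primaryComponent (↥W.sha) p) *
        (ℤ_[p] ∙ y₀).toAddSubgroup.relIndex (integralH1 (tateRep W p) p ⊤).toAddSubgroup ≤
      p ^ padicValNat p ((W.baseChange ((primePlace p).adicCompletion ℚ)).localTamagawaNumber
          ((primePlace p).adicCompletionIntegers ℚ)) * Nat.card 𝓢inf.selmerGroup * p ^ e * p ^ padicValNat p W.torsionOrder := by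
  have hp : p.Prime := Fact.out
  obtain ⟨k₁, hb⟩ := pow_dvd_relIndex_mul_pow_of_zetaLineOrthIndexAt W p y₀ e hb
  obtain ⟨j, s, k₀, hA⟩ :=
    exists_forall_aSide_sharp_le_classical_of_dvd W p 𝓤inf 𝓢inf hodd T hpT hT hUp hUur hUinl hSp hSur hSinl y₀ hy₀ N hN
  -- the level
  obtain ⟨k, hk₀, hk₁, hNe, hk1⟩ : ∃ k : ℕ, k₀ ≤ k ∧ k₁ ≤ k ∧ N + e ≤ k ∧ 1 ≤ k :=
    ⟨max (max k₀ k₁) (N + e) + 1, by omega, by omega, by omega, by omega⟩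
  haveI := neZero_pow p j; haveI := neZero_pow p s; haveI := neZero_pow p k
  haveI : Finite (geomTorsion W ((p ^ k : ℕ) : ℤ)) := finite_geomTorsion_pow W p k
  haveI : Finite (geomTorsion W ((p ^ s * p ^ k : ℕ) : ℤ)) :=
    W.finite_torsionPoints_holds (AlgebraicClosure ℚ) (Int.natCast_ne_zero.mpr (NeZero.ne (p ^ s * p ^ k)))
  have hpk2 : 2 ≤ p ^ k := le_trans hp.two_le (Nat.le_self_pow (by omega) p)
  -- the Poitou–Tate families and the GENUINE Weil data at the two auxiliary levels (alternating, non-degenerate)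
  obtain ⟨inv, hperf, hsum, -, -⟩ := hPT (p ^ j * p ^ k)
  obtain ⟨ε, hμ, hadd₁, hadd₂, halt, hnondeg, hgal⟩ := (W.exists_weilPairing_holds (p ^ j * p ^ k))
    (le_trans hpk2 (Nat.le_mul_of_pos_left _ (pow_pos hp.pos j))) (Nat.cast_ne_zero.mpr (NeZero.ne (p ^ j * p ^ k)))
  obtain ⟨inv', hperf', -, -, hcompl'⟩ := hPT (p ^ s * p ^ k)
  obtain ⟨e', hμ', hadd₁', hadd₂', halt', hnondeg', hgal'⟩ := (W.exists_weilPairing_holds (p ^ s * p ^ k))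
    (le_trans hpk2 (Nat.le_mul_of_pos_left _ (pow_pos hp.pos s))) (Nat.cast_ne_zero.mpr (NeZero.ne (p ^ s * p ^ k)))
  -- brick (b″) at the level `k`: `p^k ∣ r·p^e`, hence `p^N ∣ r` and `p^k ≤ r·p^e`
  have hbk := hb k hk₁ j inv hsum hperf ε hμ hadd₁ hadd₂ hgal halt hnondeg
  have hdvd := pow_dvd_of_pow_dvd_mul_pow hp.pos hbk hNe
  haveI : Finite (galoisCohomology (((W.torsionGaloisModule ((p ^ k : ℕ) : ℤ)).tateDual (p ^ j * p ^ k)).toLocal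
      (Sum.inr (primePlace p))) 1) := finite_galoisCohomology_one_tateDual_toLocal _ _ _
  have hrle := le_of_dvd_mul_of_ne_zero hbk (relIndex_ne_zero_of_finite _ _) (pow_ne_zero e hp.ne_zero)
  -- §2
  have h := hA k hk₀ inv hsum hperf ε hμ hadd₁ hadd₂ hgal hdvd e' hμ' hadd₁' hadd₂' hgal' halt' hnondeg' inv' hperf' hcompl'
  -- the torsion factor, `p`-part: `#W(ℚ)[p^k] ∣ p^{v_p #W(ℚ)_tors}`
  have htO : Nat.card (AddCommGroup.torsion W.toAffine.Point) = W.torsionOrder := by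
    unfold WeierstrassCurve.torsionOrder; convert rfl
  have htors : Nat.card ↥(W.toAffine.Point[((p ^ k : ℕ) : ℤ)]) ≤ p ^ padicValNat p W.torsionOrder := by
    rw [← htO]
    exact Nat.le_of_dvd (pow_pos hp.pos _) (natCard_torsionBy_pow_dvd_pow_padicValNat p k)
  exact count_arith_sharp h hrle htors (pow_pos hp.pos k)

/-- **THE SHARP LEVEL-0 COUNT FROM THE PRINT (KUMMER) FORM `ZetaLineIndexAt`** — clause (b′) of the held package `MemberHullZetaKummerCoreInputs` of
crux M, through g22's local-duality bridge `zetaLineOrthIndexAt_of_zetaLineIndexAt`: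
`p^{v_p(Tam W)} · #Ш(W)[p^∞] · [A : ℤ_p y₀] ≤ p^{v_p(c_p)} · #Sel_str^{ur}(W[p^∞]) · p^e · p^{v_p #W(ℚ)_tors}`.
[cite: Kato2004Asterisque, Prop. 14.16 (2) (p. 244) and Lemma 14.18 (pp. 247–248)] [cite: MilneADT2006, Ch. I, Cor. 2.3, Cor. 3.4, Thm. 4.10 (b)] -/
theorem tamagawa_mul_sha_mul_index_le_sharp_of_zetaLineIndexAt (hPT : poitouTate_selmerStructure_duality ℚ) (hodd : p ≠ 2)
    (T : Finset (HeightOneSpectrum (𝓞 ℚ)))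
    (hpT : primePlace p ∈ T) (hT : ∀ v : HeightOneSpectrum (𝓞 ℚ), v ∉ T → W.HasGoodReductionAt v)
    [Finite W.toAffine.Point] [Finite (AddCommGroup.primaryComponent (↥W.sha) p)]
    (hUp : 𝓤inf (Sum.inr (primePlace p)) = ⊤)
    (hUur : ∀ v : HeightOneSpectrum (𝓞 ℚ), v ≠ primePlace p →
      𝓤inf (Sum.inr v) = unramifiedSubgroup (GaloisRep.toLocal v (primaryGaloisModule W p)) 1)
    (hUinl : ∀ w : InfinitePlace ℚ, 𝓤inf (Sum.inl w) = ⊤)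
    (hSp : 𝓢inf (Sum.inr (primePlace p)) = ⊥)
    (hSur : ∀ v : HeightOneSpectrum (𝓞 ℚ), v ≠ primePlace p →
      𝓢inf (Sum.inr v) = unramifiedSubgroup (GaloisRep.toLocal v (primaryGaloisModule W p)) 1)
    (hSinl : ∀ w : InfinitePlace ℚ, 𝓢inf (Sum.inl w) = ⊤)
    (y₀ : H1 (tateRep W p) ⊤) (hy₀ : y₀ ∈ integralH1 (tateRep W p) p ⊤) (N : ℕ)
    (hN : ∀ a ∈ integralH1 (tateRep W p) p ⊤, ((p ^ N : ℕ) : ℤ) • a ∈ (ℤ_[p] ∙ y₀).toAddSubgroup) (e : ℕ)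
    (hb : ZetaLineIndexAt W p y₀ e) :
    p ^ padicValNat p W.tamagawaProduct * Nat.card (AddCommGroup.primaryComponent (↥W.sha) p) *
        (ℤ_[p] ∙ y₀).toAddSubgroup.relIndex (integralH1 (tateRep W p) p ⊤).toAddSubgroup ≤
      p ^ padicValNat p ((W.baseChange ((primePlace p).adicCompletion ℚ)).localTamagawaNumber
          ((primePlace p).adicCompletionIntegers ℚ)) * Nat.card 𝓢inf.selmerGroup * p ^ e * p ^ padicValNat p W.torsionOrder :=
  tamagawa_mul_sha_mul_index_le_sharp_of_zetaLineOrthIndexAt W p 𝓤inf 𝓢inf hPT hodd T hpT hT hUp hUur hUinl hSp hSur hSinl y₀ hy₀ N hN e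
    (zetaLineOrthIndexAt_of_zetaLineIndexAt W p y₀ e hb)

end Count

end Summit.BirchSwinnertonDyer.BirchSwinnertonDyer.Theorems.KatoFiniteLevelCount

end
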